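/-
Origin: expansion seat `planner-pub-hodgecm-qw8-g3-0`, handover 2026-08-18T05:08:48Z (`HOME/pub-hodgecm-qw8-g3/Qw8g3/Qw8MilneZero.lean`, md5 61e2946a, 233 lines);
landed by the gen-6 packager in gate run 22 as `HodgeCM/StubTree/Qw8MilneZero.lean` (import ^import Qw8g[0-9]+\.→import HodgeCM.StubTree. ×1; stripped 1 trailing import-line comments).
-/
/-
Copyright (c) 2026. All rights reserved.
Released under Apache 2.0 license as described in the file LICENSE.
Origin: expansion seat `planner-pub-hodgecm-qw8-g3-0` (unit pub-hodgecm-qw8-g3, [QW8] §2.5 holder, generation 3).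
Proposed place: `HodgeCM/StubTree/Qw8MilneZero.lean` (module `HodgeCM.StubTree.Qw8MilneZero`).  Imports: ONE queued
WIP module `Qw8g2.Qw8Milne` (seat pub-hodgecm-qw8-g2, run-22 queue, md5 f6301aa0db7c) to be rewritten
`HodgeCM.StubTree.Qw8Milne` at intake; this file lands AFTER it (and after pohl-g3's `PohlmannEq`, which that one imports).
-/
import Summits.HodgeConjecture.HodgeCM.StubTree.Qw8Milne

/-!
# The degree-0 residue of `Qw8Milne` is a theorem of the standing binders

Generation 2 (`StubTree/Qw8Milne.lean`) proved `Qw8Milne` — [QW8] Thm 2.5 step (iv), "weight vectors with vanishing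
Lefschetz character are algebraic" — in POSITIVE degree (`qw8MilnePos_of_facts`, from `ModelAxioms`, N1–N4, F4, F5) and
split off the degree-0 case as the typed residue

* `Universe.Qw8MilneZero := ∀ F Galois, 6 ≤ [F:ℚ] → ∀ z : WVec F, z.p = 0 → z.IsAlg`

("every nonzero class of `H⁰(∏ⱼ A_{Θⱼ}) ⊗ ℂ` is algebraic", i.e. the fundamental class of a CM product is algebraic),
offering the candidate fact `Fact_fundClass` to discharge it.  THIS FILE PROVES `Qw8MilneZero` WITHOUT ANY NEW FACT, from
binders that are already inputs of the certified assembly `COR_CM_of_geometricFacts`: the model axioms (M1 `pull_id`,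
M2 `pull_comp`, M3 `pull_cup`, M18 `lift`, the CM endomorphisms behind `exists_isFactorAct`), N3 `Fact_pull_H0`
(endomorphisms act trivially on `H⁰`), F2 `Fact_factorActDescends`, F5 `Fact_cupAssoc`, F6 `Fact_weightDual`,
F7 `Fact_gysin`, and gen-2's theorem `Qw8MilnePos`:

* `Universe.qw8MilneZero_of_facts : ModelAxioms → N3 → F2 → F5 → F6 → F7 → Qw8MilnePos → Qw8MilneZero`.

**Proof** (push–pull through the doubled product).  Let `x ≠ 0` in `H⁰(Y) ⊗ ℂ`, `Y = A' = ∏ⱼ A_{Θⱼ}`.  By N3, `x` is a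
weight vector of the EMPTY weight `(∅, …, ∅)` (`isWeightVector_empty_of_pull_H0`).  Put `P := A' × A'` (CM types
`Fin.append Θ Θ`, block projections `p_Y`, `p_{Y'}` onto the two copies, `blockPair_exists`).
(1) F6 on `Y'` with `q = 0`: the copy `x₃` of `x` on `Y'` has a Poincaré-dual partner `w'` of the complementary — i.e. FULL —
weight `(univ, …, univ)` in degree `2·dim Y'` with `∫ w' ∪ x₃ ≠ 0`; so `ω := w' ∪ x₃ ≠ 0` is a weight vector of the full
weight in the top degree (M3: cupping with an empty-weight vector keeps the weight, `isWeightVector_cupC_empty`).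
(2) `dim Y' > 0` (`dim_pos_of_isWeightVector_univ`): otherwise `ω` has degree 0, where the factor action of `2 ∈ 𝓞_F`
(`exists_isFactorAct`) is trivial (N3) yet multiplies `ω` by `∏_{s : F → ℂ} s(2) = 2^{[F:ℚ]} ≠ 1`.
(3) `Z := p_Y^* x₂ ∪ p_{Y'}^* ω` (`x₂` the copy of `x` on the first block) is a weight vector on `P` of weight
`(∅, …, ∅, univ, …, univ)` (F2 + M3, `isWeightVector_box`), nonzero (`box_ne_zero`: F5, F7, M3 and a partner of `ω` from
F6), of POSITIVE degree `2·dim Y'`, and its Lefschetz character is `a(∅-weight) + a(univ-weight) = 0 + 0`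
(`lefChar_append`, `lefChar_univ_eq_zero`).  Hence `Z` is algebraic by `Qw8MilnePos`.
(4) F7: the Gysin map `p_{Y*}` preserves algebraic classes and `p_{Y*}(p_Y^* x₂ ∪ p_{Y'}^* ω) = (∫_{Y'} ω) · x₂` with
`∫_{Y'} ω = ∫ w' ∪ x₃ ≠ 0`; so `x₂`, hence `x`, is algebraic of degree 0.  ∎

Consequences (no Milne binder, no `Fact_fundClass`, no [QW8] input left):
* `Universe.qw8Milne_of_facts : ModelAxioms → N1 → N2 → N3 → N4 → F2 → F4 → F5 → F6 → F7 → Qw8Milne`;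
* `Universe.qw8Sufficiency_of_geometricFacts : … → Qw8Sufficiency` ([QW8] Thm 2.5 `t:suff`, ALL steps (i)–(v) + §3 bridge);
* `Assembly.COR_CM_of_geometricFacts' : HC_CM ⇐ ModelAxioms ∧ N1–N4 ∧ F2 ∧ F4–F7 ∧ RealisationExistsFace`.

Source of the statement under adjudication: [QW8] v1 blob 892bb948, Theorem 2.5 (`t:suff`), tex ll. 245–262 of
`inputs/2001/literature__sources__internal-hodge-w-quartic-weil-eightfold-y3__paper-v1-892bb948.tex` (quoted in
`pub-hodgecm-qw8/QW8-SOURCE.md`); it is NOT cited anywhere in this file — every hypothesis below is a binder already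
adjudicated for `COR_CM_of_geometricFacts` (FACTS.md rows M*, N1–N4, F2, F4–F7).
-/

noncomputable section

open scoped TensorProduct NumberField Classical

namespace HodgeCM

open Literature.AlgebraicGeometry.Motives (CMType)

namespace Universe

variable {U : Universe}

/-! ## 1. Three small lemmas: empty weight in degree 0, cup with an empty-weight vector, positive dimension -/

/-- **N3 ⇒ every complexified class of degree 0 on a CM product is a weight vector of the EMPTY weight.** -/
theorem isWeightVector_empty_of_pull_H0 (hN3 : U.Fact_pull_H0) (F : CMField) {n : ℕ}
    (Θ : Fin (n + 1) → CMType F) (x : U.CohC (U.cmProd F Θ) (2 * 0)) :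
    U.IsWeightVector F Θ (fun _ => ∅) (2 * 0) x := by
  intro j a Ma _
  simp only [Finset.prod_empty, one_smul]
  show (U.pull Ma 0).baseChange ℂ x = x
  rw [hN3 _ Ma, LinearMap.baseChange_id, LinearMap.id_apply]

/-- **M3 ⇒ the cup product with a weight vector of the empty weight keeps the weight.** -/
theorem isWeightVector_cupC_empty (hcup : U.Fact_pull_cup) (F : CMField) {n : ℕ}
    (Θ : Fin (n + 1) → CMType F) {S : Fin (n + 1) → Finset ((F : Type) →+* ℂ)} {k l : ℕ}
    {w : U.CohC (U.cmProd F Θ) k} {x : U.CohC (U.cmProd F Θ) l}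
    (hw : U.IsWeightVector F Θ S k w) (hx : U.IsWeightVector F Θ (fun _ => ∅) l x) :
    U.IsWeightVector F Θ S (k + l) (U.cupC (U.cmProd F Θ) k l w x) := by
  intro j a Ma hMa
  rw [pullC_cupC U hcup, hw j a Ma hMa, hx j a Ma hMa, Finset.prod_empty, one_smul, map_smul,
    LinearMap.smul_apply]

/-- **A CM product carrying a nonzero weight vector of the FULL weight in degree `2·dim` has positive dimension.**
In dimension 0 that class has degree 0, where every endomorphism acts trivially (N3), whereas the full weight makes the
factor action of `2 ∈ 𝓞_F` (`exists_isFactorAct`, from the CM structure of the model) act by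
`∏_{s : F →+* ℂ} s 2 = 2 ^ [F:ℚ] ≠ 1`. -/
theorem dim_pos_of_isWeightVector_univ (M : U.ModelAxioms) (hN3 : U.Fact_pull_H0) (F : CMField) {n : ℕ}
    (Θ : Fin (n + 1) → CMType F) {ω : U.CohC (U.cmProd F Θ) (2 * U.dim (U.cmProd F Θ))} (hω0 : ω ≠ 0)
    (hωw : U.IsWeightVector F Θ (fun _ => Finset.univ) (2 * U.dim (U.cmProd F Θ)) ω) :
    0 < U.dim (U.cmProd F Θ) := by
  refine Nat.pos_of_ne_zero fun hd => hω0 ?_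
  have h20 : 2 * U.dim (U.cmProd F Θ) = 2 * 0 := by rw [hd]
  have hω₀w := U.isWeightVector_castC F Θ (fun _ => Finset.univ) h20 hωw
  obtain ⟨Ma, hMa⟩ := exists_isFactorAct M F Θ 0 2
  have h1 : U.pullC Ma (2 * 0) (U.castC _ h20 ω) =
      (∏ s ∈ (Finset.univ : Finset ((F : Type) →+* ℂ)), s ((2 : 𝓞 F) : F)) • U.castC _ h20 ω :=
    hω₀w 0 _ Ma hMa
  have h2 : U.pullC Ma (2 * 0) (U.castC _ h20 ω) = U.castC _ h20 ω := by
    show (U.pull Ma 0).baseChange ℂ (U.castC _ h20 ω) = U.castC _ h20 ω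
    rw [hN3 _ Ma, LinearMap.baseChange_id, LinearMap.id_apply]
  have h3 : (∏ s ∈ (Finset.univ : Finset ((F : Type) →+* ℂ)), s ((2 : 𝓞 F) : F)) =
      (2 : ℂ) ^ (Finset.univ : Finset ((F : Type) →+* ℂ)).card := by
    rw [← Finset.prod_const]
    refine Finset.prod_congr rfl fun s _ => ?_
    rw [NumberField.RingOfIntegers.coe_eq_algebraMap, map_ofNat, map_ofNat]
  rw [h2, h3] at h1
  have hm : (2 : ℂ) ^ (Finset.univ : Finset ((F : Type) →+* ℂ)).card ≠ 1 := by
    have hc : (Finset.univ : Finset ((F : Type) →+* ℂ)).card ≠ 0 := by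
      rw [Finset.card_univ, NumberField.Embeddings.card F ℂ]
      exact Module.finrank_pos.ne'
    exact_mod_cast (Nat.one_lt_two_pow_iff.2 hc).ne'
  have h4 : ((2 : ℂ) ^ (Finset.univ : Finset ((F : Type) →+* ℂ)).card - 1) • U.castC _ h20 ω = 0 := by
    rw [sub_smul, one_smul, ← h1, sub_self]
  have h5 : U.castC _ h20 ω = 0 := (smul_eq_zero.1 h4).resolve_left (sub_ne_zero.2 hm)
  exact (LinearEquiv.map_eq_zero_iff _).mp h5

/-! ## 2. `Qw8MilneZero` from M, N3, F2, F5, F6, F7 and `Qw8MilnePos` -/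

/-- **The degree-0 residue of Milne 1999 on CM products is a theorem of the standing binders**: every nonzero class of
`H⁰(∏ⱼ A_{Θⱼ}) ⊗ ℂ` is algebraic, given the model axioms, N3, F2, F5, F6, F7 and `Qw8Milne` in positive degree.
Push–pull through `P = A' × A'`: box the class with the top-degree full-weight partner `ω` of its copy on the second
factor (F6), observe that the box has character `0` and positive degree (so `Qw8MilnePos` makes it algebraic), and push it
down along the first projection (F7), which returns `(∫ ω) · x` with `∫ ω ≠ 0`. -/
theorem qw8MilneZero_of_facts (M : U.ModelAxioms) (hN3 : U.Fact_pull_H0) (h2 : U.Fact_factorActDescends)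
    (h5 : U.Fact_cupAssoc) (h6 : U.Fact_weightDual) (h7 : U.Fact_gysin) (hpos : U.Qw8MilnePos) :
    U.Qw8MilneZero := by
  intro F hG hF z hp
  obtain ⟨n, Θ, p, S, x, hx0, hxw⟩ := z
  change p = 0 at hp
  subst hp
  change x ∈ U.algC (U.cmProd F Θ) 0
  -- `P := A' × A'` with its block projections `pA : P → Y`, `pB : P → Y'` (`Y = Y' = A'` up to `blkA/blkB ∘ append`)
  let Ξ : Fin (n + 1 + (n + 1)) → CMType F := Fin.append Θ Θ
  have hA : blkA Ξ = Θ := blkA_append Θ Θ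
  have hB : blkB Ξ = Θ := blkB_append Θ Θ
  obtain ⟨x₂, h0x₂, -, hax₂⟩ := U.transport_wvec hA.symm 0 (fun _ => ∅) x
  obtain ⟨x₃, h0x₃, -, -⟩ := U.transport_wvec hB.symm 0 (fun _ => ∅) x
  have hx₂0 : x₂ ≠ 0 := fun h => hx0 (h0x₂.mpr h)
  have hx₃0 : x₃ ≠ 0 := fun h => hx0 (h0x₃.mpr h)
  have hx₂w := isWeightVector_empty_of_pull_H0 hN3 F (blkA Ξ) x₂
  have hx₃w := isWeightVector_empty_of_pull_H0 hN3 F (blkB Ξ) x₃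
  obtain ⟨pA, pB, hP⟩ := U.blockPair_exists M.pull_id M.pull_comp M.lift F n n Ξ
  -- (1) F6 on `Y'`, `q = 0`: the dual partner `w'` of `x₃` — full weight, top degree, `∫ w' ∪ x₃ ≠ 0`
  obtain ⟨-, w', hw'w, htr₁, -⟩ := h6 F n (blkB Ξ) 0 (fun _ => ∅) x₃ hx₃0 hx₃w
  have hw'u : U.IsWeightVector F (blkB Ξ) (fun _ => Finset.univ) (2 * (U.dim (U.cmProd F (blkB Ξ)) - 0)) w' := by
    simpa only [Finset.compl_empty] using hw'w
  have hdeg₁ : 2 * (U.dim (U.cmProd F (blkB Ξ)) - 0) + 2 * 0 = 2 * U.dim (U.cmProd F (blkB Ξ)) := by omega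
  -- `ω := w' ∪ x₃ ≠ 0`, a weight vector of the full weight in degree `2·dim Y'`
  obtain ⟨ω, hω⟩ : ∃ ω, ω = U.castC _ hdeg₁ (U.cupC (U.cmProd F (blkB Ξ)) _ _ w' x₃) := ⟨_, rfl⟩
  have hωtr : U.trC _ (2 * U.dim (U.cmProd F (blkB Ξ))) ω ≠ 0 := by rw [hω, trC_castC]; exact htr₁
  have hω0 : ω ≠ 0 := fun h => hωtr (by rw [h, map_zero])
  have hωw : U.IsWeightVector F (blkB Ξ) (fun _ => Finset.univ) (2 * U.dim (U.cmProd F (blkB Ξ))) ω := by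
    rw [hω]
    exact U.isWeightVector_castC F (blkB Ξ) _ hdeg₁ (isWeightVector_cupC_empty M.pull_cup F (blkB Ξ) hw'u hx₃w)
  -- (2) `dim Y' > 0`
  have hd : 0 < U.dim (U.cmProd F (blkB Ξ)) := dim_pos_of_isWeightVector_univ M hN3 F (blkB Ξ) hω0 hωw
  -- (3) F6 again: a partner `ω'` of `ω` (`∫ ω ∪ ω' ≠ 0`), the input of `box_ne_zero`
  obtain ⟨-, ω', -, -, htr₂⟩ := h6 F n (blkB Ξ) (U.dim (U.cmProd F (blkB Ξ))) (fun _ => Finset.univ) ω hω0 hωw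
  have hij : 2 * U.dim (U.cmProd F (blkB Ξ)) + 2 * (U.dim (U.cmProd F (blkB Ξ)) - U.dim (U.cmProd F (blkB Ξ))) =
      2 * U.dim (U.cmProd F (blkB Ξ)) := by omega
  have hZ0 : U.cupC (U.cmProd F Ξ) (2 * 0) (2 * U.dim (U.cmProd F (blkB Ξ))) (U.pullC pA (2 * 0) x₂)
      (U.pullC pB (2 * U.dim (U.cmProd F (blkB Ξ))) ω) ≠ 0 :=
    U.box_ne_zero M h5 h7 Ξ hP hx₂0 ω ω' hij (by rw [trC_castC]; exact htr₂)
  -- `Z := p_Y^* x₂ ∪ p_{Y'}^* ω`: weight `(∅,…,∅,univ,…,univ)`, degree `2·dim Y' > 0`, character `0` ⇒ algebraic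
  have hZw := isWeightVector_box M.pull_cup h2 Ξ hP hx₂w hωw
  have hdeg : 2 * 0 + 2 * U.dim (U.cmProd F (blkB Ξ)) = 2 * U.dim (U.cmProd F (blkB Ξ)) := by omega
  have hchar : lefChar Ξ (Fin.append (fun _ : Fin (n + 1) => (∅ : Finset ((F : Type) →+* ℂ)))
      (fun _ : Fin (n + 1) => (Finset.univ : Finset ((F : Type) →+* ℂ))) :) = 0 := by
    rw [lefChar_append, lefChar_univ_eq_zero, add_zero]
    unfold lefChar
    simp only [Finset.sum_empty, Finset.sum_const_zero]
  have hZalg : U.castC _ hdeg (U.cupC (U.cmProd F Ξ) (2 * 0) (2 * U.dim (U.cmProd F (blkB Ξ))) (U.pullC pA (2 * 0) x₂)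
      (U.pullC pB (2 * U.dim (U.cmProd F (blkB Ξ))) ω)) ∈ U.algC (U.cmProd F Ξ) (U.dim (U.cmProd F (blkB Ξ))) :=
    hpos F hG hF ⟨n + 1 + n, Ξ, U.dim (U.cmProd F (blkB Ξ)),
      (Fin.append (fun _ : Fin (n + 1) => (∅ : Finset ((F : Type) →+* ℂ)))
        (fun _ : Fin (n + 1) => (Finset.univ : Finset ((F : Type) →+* ℂ))) :),
      U.castC _ hdeg (U.cupC (U.cmProd F Ξ) (2 * 0) (2 * U.dim (U.cmProd F (blkB Ξ))) (U.pullC pA (2 * 0) x₂)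
        (U.pullC pB (2 * U.dim (U.cmProd F (blkB Ξ))) ω)),
      fun h => hZ0 ((LinearEquiv.map_eq_zero_iff _).mp h), U.isWeightVector_castC F Ξ _ hdeg hZw⟩ hd hchar
  -- (4) F7: `p_{Y*} Z = (∫_{Y'} ω) · x₂` is algebraic of degree 0, and `∫_{Y'} ω ≠ 0`
  obtain ⟨gy, hgy1, hgy2⟩ := h7 F n n Ξ pA pB hP
  have hA2 := (U.castC_mem_algC_iff (U.cmProd F Ξ)
    (by omega : U.dim (U.cmProd F (blkB Ξ)) = 0 + U.dim (U.cmProd F (blkB Ξ))) (by omega) _).mpr hZalg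
  have hA3 := gyC_mem_algC gy hgy1 0 hA2 (by omega)
  simp only [castC_castC, castC_self] at hA3
  rw [gyC_proj gy hgy2] at hA3
  exact hax₂.mpr ((Submodule.smul_mem_iff _ hωtr).mp hA3)

/-! ## 3. Consequences: `Qw8Milne`, `Qw8Sufficiency`, COR-CM without any Milne / [QW8] binder -/

/-- **`Qw8Milne` ([QW8] Thm 2.5 step (iv), "Milne 1999 for CM abelian varieties", in the eigen-weight form used by the
stub tree) is a THEOREM of the model axioms, the standard facts N1–N4 and F2, F4–F7** — all degrees. -/
theorem qw8Milne_of_facts (M : U.ModelAxioms) (hN1 : U.Fact_cupExterior) (hN2 : U.Fact_cup_hodge)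
    (hN3 : U.Fact_pull_H0) (hN4 : U.Fact_hodge_F0) (h2 : U.Fact_factorActDescends) (h4 : U.Fact_cupAlg)
    (h5 : U.Fact_cupAssoc) (h6 : U.Fact_weightDual) (h7 : U.Fact_gysin) : U.Qw8Milne :=
  qw8Milne_of_pos_of_zero (qw8MilnePos_of_facts M hN1 hN2 hN3 hN4 h4 h5)
    (qw8MilneZero_of_facts M hN3 h2 h5 h6 h7 (qw8MilnePos_of_facts M hN1 hN2 hN3 hN4 h4 h5))

/-- **`Qw8Sufficiency` ([QW8] Thm 2.5 `t:suff`) from the model axioms, N1–N4 and F2, F4–F7 only**: every step (i)–(v) and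
the §3 ā-bridge is now a theorem of these binders (`qw8Conj_holds`, `qw8ExtProd_of_facts`, `qw8DualPushPull_of_facts`,
`qw8Milne_of_facts`, `qw8FaceBridge_holds`). -/
theorem qw8Sufficiency_of_geometricFacts (M : U.ModelAxioms) (hN1 : U.Fact_cupExterior) (hN2 : U.Fact_cup_hodge)
    (hN3 : U.Fact_pull_H0) (hN4 : U.Fact_hodge_F0) (h2 : U.Fact_factorActDescends) (h4 : U.Fact_cupAlg)
    (h5 : U.Fact_cupAssoc) (h6 : U.Fact_weightDual) (h7 : U.Fact_gysin) : U.Qw8Sufficiency :=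
  U.qw8Sufficiency_of_facts M h2 h4 h5 h6 h7 (qw8Milne_of_facts M hN1 hN2 hN3 hN4 h2 h4 h5 h6 h7)

end Universe

namespace Assembly

/-- **COR-CM from the model and the standard facts alone.**  The Hodge conjecture for CM abelian varieties from: the
model axioms M1–M28 (`ModelAxioms`), the standard facts N1–N4 (`Fact_cupExterior`, `Fact_cup_hodge`, `Fact_pull_H0`,
`Fact_hodge_F0`), F2, F4–F7 (`Fact_factorActDescends`, `Fact_cupAlg`, `Fact_cupAssoc`, `Fact_weightDual`, `Fact_gysin`)
and the theta realisation over a rank-four face (`RealisationExistsFace`, PerL side).  Compared with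
`COR_CM_of_geometricFacts` (run 21) the binder `hMi : Qw8Milne` is GONE: Pohlmann (both directions) and [QW8] Thm 2.5
(all five steps, all degrees) are theorems. -/
theorem COR_CM_of_geometricFacts' (U : Universe) (M : U.ModelAxioms) (hR : U.RealisationExistsFace)
    (hN1 : U.Fact_cupExterior) (hN2 : U.Fact_cup_hodge) (hN3 : U.Fact_pull_H0) (hN4 : U.Fact_hodge_F0)
    (h2 : U.Fact_factorActDescends) (h4 : U.Fact_cupAlg) (h5 : U.Fact_cupAssoc) (h6 : U.Fact_weightDual)
    (h7 : U.Fact_gysin) : U.HC_CM :=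
  COR_CM_of_geometricFacts_zero U M hR hN1 hN2 hN3 hN4 h2 h4 h5 h6 h7
    (U.qw8MilneZero_of_facts M hN3 h2 h5 h6 h7 (U.qw8MilnePos_of_facts M hN1 hN2 hN3 hN4 h4 h5))

end Assembly

end HodgeCM

end
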